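import Summits.ABC.ABC.Theses.CubicResolventAllowance
import HarnessLib

/-!
# stub-ideation k2 (RESHAPE) — generation 13 sketch for `stub_complexCubic` (crux `IndexSzpiro`, stmt-ABC-22740)

Companion to `STUB-IDEAS-stub_complexCubic-2.md` (gen 13).  Gens 1–12 of this slot stand BY REFERENCE
(`StubIdeas2G*Sketch.lean`, same directory, not importable on the farm).  This file types ONLY what gen 13 adds:
the PENCIL NORMAL FORM of the complex class (RESHAPE cell "change the quantified object: fix the quadratic
resolvent `F = ℚ(√Δ) = ℚ(√d_K)`").

* P1  `j − 1728 = c₆² / Δ`                         (S, proved)   [SilvermanAEC2009 III.1; Diamond–Kramer,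
      cornell1997 p.580: `Δ = 12⁶ j²/(j−1728)³ · □`]
* P2  `Irreducible ψ₂(W) → c₆(W) ≠ 0`               (S, proved)   — `j = 1728` never occurs in the `r = 0` class
      (the rational point `x₀ = −b₂/12` is a root of `ψ₂` iff `c₆ = 0`).
* P3  `Δ(W) = q²·d_K → ∃ y, j(W) = 1728 + d_K·y²`   (S, proved)   — every member of the class lies on the
      `d_K`-twisted `X_ns(2)` conic pencil `j = 1728 + d·y²` of its quadratic resolvent `ℚ(√d)`; with P2 the
      parameter `y = c₆/(q·d_K)` is nonzero, so (P4) `j < 1728 ↔ d_K < 0`: the "complex" hypothesis of the stub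
      is exactly "resolvent imaginary" / "left half of the j-line".
* P5  `StubFixedResolvent d` — the stub with `C = C(ε, d)` for pairs whose resolvent class is `d`
      (`d_K = d·f²`, Hasse) — and the trivial `Stub → ∀ d, StubFixedResolvent d`.  Already `d = −3`
      (pure cubic fields, `j = 1728 − 3y²`) contains k1-g13's `ℚ(∛2)` pencil, on which the stub is the OPEN
      polynomial radical bound for `2n³ − 1`; so the quantifier reshape exposes no tool (see the .md, §1 B).

The hypothesis `Δ(W) = q²·d_K` (k3 H1 `DiscSqRatio` / k1-G5 `discSqRatio`, kernel-checked in
`StubIdeas1G5Sketch.lean`) is taken as an explicit binder, as in k2-G4 `discr_neg_iff_Δ_neg`.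
-/

open Polynomial
open scoped NumberField

set_option linter.dupNamespace false

namespace Summit.ABC.ABC.Cruxes.IndexSzpiro.StubIdeas2G13

/-! ## §0  The stub (verbatim) -/

/-- `stub_complexCubic`, verbatim (registered signature, skeleton sha d34fb8f2…). -/
def Stub : Prop :=
  ∀ ε : ℝ, 0 < ε → ∃ C : ℝ, ∀ (W : WeierstrassCurve ℚ) [W.IsElliptic] (K : Type) [Field K] [NumberField K],
    Irreducible W.twoTorsionPolynomial.toPoly → Module.finrank ℚ K = 3 →
    (∃ θ : K, aeval θ W.twoTorsionPolynomial.toPoly = 0) → NumberField.discr K < 0 →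
    (W.minimalDiscriminantNorm ℤ : ℝ) ≤ C * |(NumberField.discr K : ℝ)| * (W.conductorNorm ℤ : ℝ) ^ (6 + ε)

/-! ## §P  Pencil normal form of the complex class -/

/-- **P1 (S, proved).** `j − 1728 = c₆²/Δ` for an elliptic curve over `ℚ`
(Mathlib `j = Δ'⁻¹·c₄³`, `c_relation : 1728Δ = c₄³ − c₆²`). -/
theorem j_sub_eq (W : WeierstrassCurve ℚ) [W.IsElliptic] : W.j - 1728 = W.c₆ ^ 2 / W.Δ := by
  have hΔ : W.Δ ≠ 0 := W.isUnit_Δ.ne_zero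
  have h1 : W.j = W.c₄ ^ 3 / W.Δ := by
    rw [WeierstrassCurve.j, Units.val_inv_eq_inv_val, WeierstrassCurve.coe_Δ', div_eq_inv_mul]
  rw [h1, eq_div_iff hΔ, sub_mul, div_mul_cancel₀ _ hΔ]
  linear_combination -W.c_relation

/-- **P2 (S, proved).** In the `r = 0` class `c₆ ≠ 0` (equivalently `j ≠ 1728`): if `c₆ = 0` the rational
number `x₀ = −b₂/12` is a root of the 2-division cubic (`ψ₂(x − b₂/12) = 4x³ − (c₄/12)x − c₆/216`). -/
theorem c₆_ne_zero_of_irreducible (W : WeierstrassCurve ℚ)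
    (hirr : Irreducible W.twoTorsionPolynomial.toPoly) : W.c₆ ≠ 0 := by
  intro hc
  have hc' : -W.b₂ ^ 3 + 36 * W.b₂ * W.b₄ - 216 * W.b₆ = 0 := hc
  have hroot : (W.twoTorsionPolynomial.toPoly).IsRoot (-W.b₂ / 12) := by
    simp only [Polynomial.IsRoot, Cubic.toPoly, WeierstrassCurve.twoTorsionPolynomial, eval_add, eval_mul,
      eval_C, eval_pow, eval_X]
    linear_combination (-1 / 216 : ℚ) * hc'
  have hdeg := Polynomial.degree_eq_one_of_irreducible_of_root hirr hroot
  have h3 : W.twoTorsionPolynomial.toPoly.degree = 3 :=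
    Cubic.degree_of_a_ne_zero (by norm_num [WeierstrassCurve.twoTorsionPolynomial])
  rw [h3] at hdeg
  exact absurd hdeg (by decide)

/-- **P3 (S, proved).** PENCIL PARAMETRISATION: if `Δ(W) = q²·d_K` (k3 H1 / k1-G5 `discSqRatio`) then
`j(W) = 1728 + d_K·y²` with `y = c₆/(q·d_K) ∈ ℚ` — `W` is a rational point of the `d_K`-twisted conic
`X_ns(2)^{(d_K)} ≅ ℙ¹`, i.e. the class fibres over its quadratic resolvents `ℚ(√d_K)` into genus-0 pencils. -/
theorem exists_pencil_param (W : WeierstrassCurve ℚ) [W.IsElliptic] (K : Type) [Field K] [NumberField K]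
    {q : ℚ} (hq : q ≠ 0) (hΔ : W.Δ = q ^ 2 * (NumberField.discr K : ℚ)) :
    ∃ y : ℚ, W.j = 1728 + (NumberField.discr K : ℚ) * y ^ 2 := by
  have hd : (NumberField.discr K : ℚ) ≠ 0 := by exact_mod_cast NumberField.discr_ne_zero K
  refine ⟨W.c₆ / (q * (NumberField.discr K : ℚ)), ?_⟩
  have h := j_sub_eq W
  rw [hΔ] at h
  have h' : W.j = 1728 + W.c₆ ^ 2 / (q ^ 2 * (NumberField.discr K : ℚ)) := by linarith
  rw [h']
  congr 1
  field_simp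

/-- **P4a (S, proved).** With `c₆ ≠ 0`: `j < 1728 ↔ Δ < 0` (`E(ℝ)` connected). -/
theorem j_lt_iff_Δ_neg (W : WeierstrassCurve ℚ) [W.IsElliptic] (hc : W.c₆ ≠ 0) :
    W.j < 1728 ↔ W.Δ < 0 := by
  have h := j_sub_eq W
  have hc2 : 0 < W.c₆ ^ 2 := by positivity
  constructor
  · intro hj
    by_contra hΔ
    have : 0 ≤ W.c₆ ^ 2 / W.Δ := div_nonneg hc2.le (not_lt.mp hΔ)
    linarith
  · intro hΔ
    have : W.c₆ ^ 2 / W.Δ < 0 := div_neg_of_pos_of_neg hc2 hΔ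
    linarith

/-- **P4 (S, proved).** In the class, the stub's sign hypothesis is the left half of the `j`-line:
`d_K < 0 ↔ j(W) < 1728` (given `Δ = q²·d_K`, and `Irreducible ψ₂` for `c₆ ≠ 0`). -/
theorem discr_neg_iff_j_lt (W : WeierstrassCurve ℚ) [W.IsElliptic] (K : Type) [Field K] [NumberField K]
    (hirr : Irreducible W.twoTorsionPolynomial.toPoly)
    {q : ℚ} (hq : q ≠ 0) (hΔ : W.Δ = q ^ 2 * (NumberField.discr K : ℚ)) :
    NumberField.discr K < 0 ↔ W.j < 1728 := by
  rw [j_lt_iff_Δ_neg W (c₆_ne_zero_of_irreducible W hirr), hΔ]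
  have hq2 : 0 < q ^ 2 := by positivity
  constructor
  · intro h
    exact mul_neg_of_pos_of_neg hq2 (by exact_mod_cast h)
  · intro h
    refine lt_of_not_ge fun hc => ?_
    have : (0 : ℚ) ≤ q ^ 2 * (NumberField.discr K : ℚ) := mul_nonneg hq2.le (by exact_mod_cast hc)
    linarith

/-! ## §Q  The quantifier reshape `C(ε) ↦ C(ε, F)` (fixed quadratic resolvent) -/

/-- **P5 `StubFixedResolvent d`.** The stub with the constant allowed to depend on the resolvent class `d`
(`d_K = d·f²`, `f` the conductor of `K` over its quadratic resolvent — Hasse 1930, Cohen 1993 §6.4.5).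
For `d = −3` (pure cubic fields) this already contains the `ℚ(∛2)` pencil `y² = x³ − 6nx − (4n³+2)` of
k1-g13, on which it is the OPEN polynomial radical bound `(2n³−1)² ≤ C·rad(6n(2n³−1))^{6+ε}`-type statement. -/
def StubFixedResolvent (d : ℤ) : Prop :=
  ∀ ε : ℝ, 0 < ε → ∃ C : ℝ, ∀ (W : WeierstrassCurve ℚ) [W.IsElliptic] (K : Type) [Field K] [NumberField K],
    Irreducible W.twoTorsionPolynomial.toPoly → Module.finrank ℚ K = 3 →
    (∃ θ : K, aeval θ W.twoTorsionPolynomial.toPoly = 0) → NumberField.discr K < 0 →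
    (∃ f : ℤ, NumberField.discr K = d * f ^ 2) →
    (W.minimalDiscriminantNorm ℤ : ℝ) ≤ C * |(NumberField.discr K : ℝ)| * (W.conductorNorm ℤ : ℝ) ^ (6 + ε)

/-- **(S, proved, trivial direction).** The stub gives every fixed-resolvent instance with the SAME constant;
the converse (`∀ d, StubFixedResolvent d → Stub`) is the uniformity-in-`F` problem and is not claimed. -/
theorem stubFixedResolvent_of_stub (h : Stub) (d : ℤ) : StubFixedResolvent d := by
  intro ε hε
  obtain ⟨C, hC⟩ := h ε hε
  exact ⟨C, fun W _ K _ _ hirr h3 hθ hneg _ => hC W K hirr h3 hθ hneg⟩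

end Summit.ABC.ABC.Cruxes.IndexSzpiro.StubIdeas2G13
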